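import Literature.NumberTheory.Rogawski1990.LocalStableClassesNonsplitTypeTwoNorms
import Literature.NumberTheory.Rogawski1990.StableClassesTypeTwoFrame
import Literature.NumberTheory.Rogawski1990.LocalStableClassesNonsplit
import Literature.LinearAlgebra.Matrix.BlockCentralizerDisjointSpectra
import HarnessLib

/-!
# THE LOCAL CLASS SET OF A TYPE (2) TORUS HAS TWO ELEMENTS: at a non-split finite place, the `U(H)(F_v)`-classes inside the stable class of a unitary
# `γ` with an irreducible quadratic block (`T = T_K × E¹`) are exactly `[γ]` and one other (Rogawski 1990, §3.5 Prop. 3.5.2 (c), §3.6 type (2): `|𝓡(T∕F)| = 2`)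

Topic `NumberTheory/Rogawski1990`; namespace `Literature.NumberTheory.Rogawski1990`.  THEOREMS ONLY (no definition, no named fact, no instance, no notation, no
`sorry`).  Cell `pub/hodgecm-mathlib`, programme P3a, road «D-N7-inert» (inert unit fundamental lemma [Rogawski1990, Prop. 4.9.1 (b)]; map §3 (L4)∕§5 (D5)),
brick (L4a) «LOCAL CLASS SET», TYPE (2) — the COUNT, sequel and twin of ★ `LocalStableClassesNonsplitTypeOneCount` (B-p04: type (1), four classes).  Over ★
`StableClassesTypeTwoFrame` (the `(2,1)` block frame: `H_P = [G₁ 0; 0 g₃]`, `⋆` and `det` in the frame), ★ `LinearAlgebra.Matrix.BlockCentralizerDisjointSpectra`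
(B-p18: `Z(γ) = P · {[α + βA, 0; 0 t]} · P⁻¹`), ★ `LocalStableClassesNonsplit` §2 (B-p04: local realisation of Cartan classes with norm determinant), ★
`LocalStableClassesNonsplitTypeTwoNorms` ((N1) a `⋆`-symmetric `Y₀ ∈ E_v[A]` with NON-norm `det`, (N2) norm `det` ⇒ `Y = S⋆S`) and ★ `QuadraticLocalNormGroupNonsplit`
(B-p04: two non-norms differ by a norm).  HC_CM is proved only modulo the printed citations until rung 0 closes; this file is unconditional local algebra.

THE MATHEMATICS.  `γ ∈ U(H)(F_v)` (`H ∈ M₃(E_v)` hermitian, unit determinant, `v` non-split) with a block frame `γ P = P [A 0; 0 u]`, `χ_A` IRREDUCIBLE over `E_v` (type (2):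
`Z(γ) = E_v[γ] ≅ L′ × E_v`, `L′ = E_v[A]` a quadratic field).  A stable conjugator `g` (`g γ g⁻¹ ∈ U(H)`) has Cartan class `x = H⁻¹ H_g = P [Y 0; 0 t] P⁻¹` with
`Y = Y⋆_{G₁} ∈ E_v[A]`, `t = σ t`, `det Y · t ∈ N(E_v^×)` (★ frame file), and two stable conjugators give conjugate elements iff their classes differ by `T⋆ · T`,
`T ∈ Z(γ)^×` (★ `exists_unitary_conj_iff_exists_hermStar_mul_mul_eq_one`, ★ `exists_unitary_conj_of_inv_mul_twistGram_eq`).  Hence: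
* `δ₀`: realise `x₀ = P [Y₀ 0; 0 det Y₀] P⁻¹` (`Y₀` from (N1), `det x₀ = σ(det Y₀) det Y₀` a norm; ★ `exists_isStablyConj_inv_mul_twistGram_eq_of_det`) — it is NOT
  conjugate to `γ`: `T⋆ x₀ T = 1` would read `σ(s) det Y₀ s = 1` in the corner;
* every `δ′` in the stable class is conjugate to `γ` or to `δ₀` according as its corner `t` is a norm or not: if `t = σ(s) s` then `det Y` is a norm, `Y = S⋆S` (N2) and
  `x = T⋆T` for `T = P [S 0; 0 s] P⁻¹`; if not, `t = σ(s) s · det Y₀` (two non-norms differ by a norm), `Y Y₀⁻¹ = S⋆S` (N2) and `x = T⋆ x₀ T`.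
So **`conjClassesIn σ H γ = {[γ], [δ₀]}`** and **`ncard = 2 = 2^{r−1}`, `r = 2`** ([Prop. 3.5.2 (c)]; the two classes carry `κ_H = +1, −1` by ★ `finKappaAt_eq_ite_of_eigenvector`
read on the `u`-line, whose `H`-length is multiplied by the corner `t`).

## References
* [Rogawski1990] J. D. Rogawski, *Automorphic Representations of Unitary Groups in Three Variables*, Ann. of Math. Stud. 123 (1990), §3.1 p. 19, §3.5 Prop. 3.5.2 (a)(c)
  p. 29, §3.6 p. 31, §4.9 Prop. 4.9.1 p. 55.
* [Kottwitz1986] R. E. Kottwitz, *Stable trace formula: elliptic singular terms*, Math. Ann. 275 (1986), §7.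
-/

set_option autoImplicit false

noncomputable section

open Matrix NumberField IsDedekindDomain
open scoped MatrixGroups

namespace Literature.NumberTheory.Rogawski1990

open Literature.NumberTheory.Automorphic Literature.NumberTheory.Automorphic.UnitaryGroup Literature.NumberTheory.QuadraticForms
open Literature.AlgebraicGeometry.ShimuraVarieties (unitaryGroup mem_unitaryGroup_iff)
open Literature.LinearAlgebra.Matrix (eval_charpoly_ne_zero_of_irreducible commute_iff_exists_smul_one_add_smul_of_irreducible
  exists_eq_smul_one_add_smul_of_commute commute_smul_one_add_smul)

/-! ## §1 Generic helpers: conjugacy inside `U(H)`, norms `σ(z) z`, inverses in `K[A]` -/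

section Generic

variable {K : Type*} [Field K] (σ : K →+* K)

/-- Conjugacy in the subgroup `U(H)(K)` unfolded to the ambient `GL₃`. [cite: Rogawski1990, §3.1 p. 19] -/
private theorem isConj_iff_exists_mem {n : Type*} [Fintype n] [DecidableEq n] {H : Matrix n n K} (γ δ : unitaryGroup σ H) :
    IsConj γ δ ↔ ∃ u : GL n K, u ∈ unitaryGroup σ H ∧ u * γ.val * u⁻¹ = δ.val := by
  rw [isConj_iff]
  constructor
  · rintro ⟨c, hc⟩
    exact ⟨c.val, c.2, congrArg Subtype.val hc⟩
  · rintro ⟨u, hu, h⟩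
    exact ⟨⟨u, hu⟩, Subtype.ext h⟩

/-- Norms `σ(z) z` of units form a group: quotient. [folklore] -/
private theorem exists_norm_div (hσ : ∀ r, σ (σ r) = r) {a b z₁ z₂ : K} (hz₁ : IsUnit z₁) (hz₂ : IsUnit z₂) (ha : a = σ z₁ * z₁) (hab : a * b = σ z₂ * z₂) :
    ∃ z : K, IsUnit z ∧ b = σ z * z := by
  have ha0 : a ≠ 0 := by rw [ha]; exact ((hz₁.map σ).mul hz₁).ne_zero
  refine ⟨z₂ * z₁⁻¹, hz₂.mul (hz₁.ne_zero.isUnit.inv), ?_⟩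
  have _ := hσ
  rw [map_mul, map_inv₀]
  field_simp [hz₁.ne_zero, (hz₁.map σ).ne_zero]
  linear_combination hab - b * ha

/-- Inverses in `K[A]`: for `Y = a + bA` with `det Y ≠ 0`, `Y⁻¹ = a′ + b′A` with `Y⁻¹ Y = Y Y⁻¹ = 1`, and `Y⁻¹` is `⋆`-fixed when `Y` is (`G` invertible).
[cite: Rogawski1990, §3.5 p. 29] -/
private theorem exists_inv_smul_one_add_smul {G A : Matrix (Fin 2) (Fin 2) K} (hG : IsUnit G.det) {a b : K}
    (hY : (a • (1 : Matrix (Fin 2) (Fin 2) K) + b • A).det ≠ 0) (hYs : hermStar σ G (a • (1 : Matrix (Fin 2) (Fin 2) K) + b • A) = a • 1 + b • A) :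
    ∃ a' b' : K, (a' • (1 : Matrix (Fin 2) (Fin 2) K) + b' • A) * (a • 1 + b • A) = 1 ∧ (a • (1 : Matrix (Fin 2) (Fin 2) K) + b • A) * (a' • 1 + b' • A) = 1 ∧
      hermStar σ G (a' • (1 : Matrix (Fin 2) (Fin 2) K) + b' • A) = a' • 1 + b' • A := by
  obtain ⟨Y, hYdef⟩ : ∃ Y : Matrix (Fin 2) (Fin 2) K, Y = a • 1 + b • A := ⟨_, rfl⟩
  rw [← hYdef] at hY hYs ⊢
  have hinv : Y⁻¹ = (Y.det⁻¹ * (Y.trace - a)) • (1 : Matrix (Fin 2) (Fin 2) K) + (-(Y.det⁻¹ * b)) • A := by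
    have e : Y.trace • (1 : Matrix (Fin 2) (Fin 2) K) - Y = (Y.trace - a) • 1 + (-b) • A := by
      conv_lhs => arg 2; rw [hYdef]
      module
    rw [inv_eq_smul_trace_smul_one_sub hY, e, smul_add, smul_smul, smul_smul, mul_neg]
  have hYu : IsUnit Y.det := Ne.isUnit hY
  refine ⟨Y.det⁻¹ * (Y.trace - a), -(Y.det⁻¹ * b), ?_, ?_, ?_⟩
  · rw [← hinv, Matrix.nonsing_inv_mul Y hYu]
  · rw [← hinv, Matrix.mul_nonsing_inv Y hYu]
  · rw [← hinv]
    -- `(Y⁻¹)⋆ Y⋆ = (Y Y⁻¹)⋆ = 1`, so `(Y⁻¹)⋆ = (Y⋆)⁻¹ = Y⁻¹`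
    have h1 : hermStar σ G Y⁻¹ * Y = 1 := by
      calc hermStar σ G Y⁻¹ * Y = hermStar σ G Y⁻¹ * hermStar σ G Y := by rw [hYs]
        _ = hermStar σ G (Y * Y⁻¹) := (hermStar_mul σ G hG Y Y⁻¹).symm
        _ = 1 := by rw [Matrix.mul_nonsing_inv Y hYu, hermStar_one σ G hG]
    exact (Matrix.inv_eq_left_inv h1).symm

/-- `P⁻¹ · P = 1` on matrices for `P ∈ GL_n`. [folklore] -/
private theorem coe_inv_mul_coe {n : Type*} [Fintype n] [DecidableEq n] (P : GL n K) : (P⁻¹).val * P.val = 1 := by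
  rw [← Units.val_mul, inv_mul_cancel, Units.val_one]

/-- `P · P⁻¹ = 1` on matrices for `P ∈ GL_n`. [folklore] -/
private theorem coe_mul_coe_inv {n : Type*} [Fintype n] [DecidableEq n] (P : GL n K) : P.val * (P⁻¹).val = 1 := by
  rw [← Units.val_mul, mul_inv_cancel, Units.val_one]

/-- **`T⋆ x T` in the block frame**: for `H_P = [G₁ 0; 0 g₃]`, `T = P [S 0; 0 s] P⁻¹` and `x = P [Y 0; 0 t] P⁻¹`:
`T⋆ x T = P [S⋆ Y S 0; 0 σ(s) t s] P⁻¹`. [cite: Rogawski1990, §3.5 Prop. 3.5.2 (a) p. 29] -/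
private theorem hermStar_mul_mul_conj_blockFrame {m n : Type*} [Fintype m] [DecidableEq m] [Fintype n] [DecidableEq n] (e : m ⊕ Fin 1 ≃ n)
    {H : Matrix n n K} {P : GL n K} {G₁ : Matrix m m K} {g₃ : K} (hT : twistGram σ H P.val = reindex e e (fromBlocks G₁ 0 0 !![g₃]))
    (hG₁ : IsUnit G₁.det) (hg₃ : g₃ ≠ 0) (S Y : Matrix m m K) (s t : K) :
    hermStar σ H (P.val * reindex e e (fromBlocks S 0 0 !![s]) * (P⁻¹).val) * (P.val * reindex e e (fromBlocks Y 0 0 !![t]) * (P⁻¹).val) *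
        (P.val * reindex e e (fromBlocks S 0 0 !![s]) * (P⁻¹).val) =
      P.val * reindex e e (fromBlocks (hermStar σ G₁ S * Y * S) 0 0 !![σ s * t * s]) * (P⁻¹).val := by
  rw [hermStar_conj_blockFrame σ e H hT hG₁ hg₃]
  have ePP : ∀ X : Matrix n n K, (P⁻¹).val * (P.val * X) = X := fun X => by rw [← Matrix.mul_assoc, coe_inv_mul_coe, Matrix.one_mul]
  simp only [Matrix.mul_assoc, ePP]
  rw [← Matrix.mul_assoc (reindex e e _), blockFrame_mul, ← Matrix.mul_assoc (reindex e e _), blockFrame_mul]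
  simp only [Matrix.mul_assoc]

/-- **`T⋆ x` in the block frame**: `T⋆ · (P [Y 0; 0 t] P⁻¹) = P [S⋆ Y 0; 0 σ(s) t] P⁻¹` for `T = P [S 0; 0 s] P⁻¹`. [cite: Rogawski1990, §3.5 Prop. 3.5.2 (a) p. 29] -/
private theorem hermStar_mul_conj_blockFrame {m n : Type*} [Fintype m] [DecidableEq m] [Fintype n] [DecidableEq n] (e : m ⊕ Fin 1 ≃ n)
    {H : Matrix n n K} {P : GL n K} {G₁ : Matrix m m K} {g₃ : K} (hT : twistGram σ H P.val = reindex e e (fromBlocks G₁ 0 0 !![g₃]))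
    (hG₁ : IsUnit G₁.det) (hg₃ : g₃ ≠ 0) (S Y : Matrix m m K) (s t : K) :
    hermStar σ H (P.val * reindex e e (fromBlocks S 0 0 !![s]) * (P⁻¹).val) * (P.val * reindex e e (fromBlocks Y 0 0 !![t]) * (P⁻¹).val) =
      P.val * reindex e e (fromBlocks (hermStar σ G₁ S * Y) 0 0 !![σ s * t]) * (P⁻¹).val := by
  rw [hermStar_conj_blockFrame σ e H hT hG₁ hg₃]
  have ePP : ∀ X : Matrix n n K, (P⁻¹).val * (P.val * X) = X := fun X => by rw [← Matrix.mul_assoc, coe_inv_mul_coe, Matrix.one_mul]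
  simp only [Matrix.mul_assoc, ePP]
  rw [← Matrix.mul_assoc (reindex e e _), blockFrame_mul]

end Generic

/-! ## §2 The Cartan class of a stable conjugator in the block frame (local, non-split `v`) -/

section Local

variable {F : Type} (E : Type) [Field F] [NumberField F] [Field E] [NumberField E] [Algebra F E]
  [Algebra.IsQuadraticExtension F E] (v : HeightOneSpectrum (𝓞 F)) (c : E ≃ₐ[F] E) {δ : E} (hcδ : c δ = -δ) (hδ : δ ≠ 0)
variable {H : Matrix (Fin 3) (Fin 3) (LocalRing E v)} {γ P : GL (Fin 3) (LocalRing E v)} (e : Fin 2 ⊕ Fin 1 ≃ Fin 3)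
  {A : Matrix (Fin 2) (Fin 2) (LocalRing E v)} {u : LocalRing E v}

include hcδ hδ in
/-- `δ² ∈ F`: for a quadratic `E∕F` and `c δ = -δ ≠ 0` there is `d ∈ F` with `δ · δ = d` (as in ★ `QuadraticLocalNormGroupNonsplit`, private there). [folklore] -/
private theorem exists_delta_mul_self_eq_algebraMap'' : ∃ d : F, δ * δ = algebraMap F E d := by
  obtain ⟨x, y, hxy⟩ := exists_eq_add_mul_of_isQuadraticExtension (F := F) (E := E) (not_mem_range_algebraMap_of_apply_eq_neg E c hcδ hδ) (δ * δ)
  have hc2 : c (δ * δ) = δ * δ := by rw [map_mul, hcδ, neg_mul_neg]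
  have hy : algebraMap F E y * δ = 0 := by
    have h1 : c (δ * δ) = algebraMap F E x - algebraMap F E y * δ := by
      rw [hxy, map_add, map_mul, AlgEquiv.commutes, AlgEquiv.commutes, hcδ, mul_neg, sub_eq_add_neg]
    rw [hc2, hxy] at h1
    have h2 : (2 : E) * (algebraMap F E y * δ) = 0 := by linear_combination h1
    exact (mul_eq_zero.1 h2).resolve_left two_ne_zero
  exact ⟨x, by rw [hxy, hy, add_zero]⟩

include hcδ hδ in
/-- **The Cartan class of a stable conjugator in the block frame** (type (2), non-split `v`): for `γ ∈ U(H)(F_v)` with `γ P = P [A 0; 0 u]`, `χ_A` irreducible,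
`H_P = [G₁ 0; 0 g₃]`, and `g` with `g γ g⁻¹ ∈ U(H)(F_v)`: `P⁻¹ (H⁻¹ H_g) P = [Y 0; 0 t]` with `Y = α + βA` `⋆_{G₁}`-symmetric with unit determinant, `t = σ t ≠ 0`,
and `det Y · t = σ(det g) det g`. [cite: Rogawski1990, §3.1 p. 19; §3.5 Prop. 3.5.2 (a)(c) p. 29; §3.6 p. 31] -/
theorem exists_cartan_blockFrame_eq (w : PlacesOver E v) (hw : c • w.1 = w.1) (hH : (H.map (conjLocal E c v))ᵀ = H) (hHd : IsUnit H.det)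
    (hγ : γ ∈ unitaryGroup (conjLocal E c v) H) (hP : γ.val * P.val = P.val * reindex e e (fromBlocks A 0 0 !![u])) (hA : Irreducible A.charpoly)
    {G₁ : Matrix (Fin 2) (Fin 2) (LocalRing E v)} {g₃ : LocalRing E v}
    (hT : twistGram (conjLocal E c v) H P.val = reindex e e (fromBlocks G₁ 0 0 !![g₃])) {g : GL (Fin 3) (LocalRing E v)}
    (hg : g * γ * g⁻¹ ∈ unitaryGroup (conjLocal E c v) H) :
    ∃ (α β t : LocalRing E v), (P⁻¹).val * (H⁻¹ * twistGram (conjLocal E c v) H g.val) * P.val = reindex e e (fromBlocks (α • 1 + β • A) 0 0 !![t]) ∧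
      hermStar (conjLocal E c v) G₁ (α • (1 : Matrix (Fin 2) (Fin 2) (LocalRing E v)) + β • A) = α • 1 + β • A ∧ conjLocal E c v t = t ∧
      (α • (1 : Matrix (Fin 2) (Fin 2) (LocalRing E v)) + β • A).det * t = conjLocal E c v g.val.det * g.val.det ∧ t ≠ 0 ∧
      IsUnit (α • (1 : Matrix (Fin 2) (Fin 2) (LocalRing E v)) + β • A).det := by
  letI : Field (LocalRing E v) := (Liu2021.LemD1IndexedNonVacuityNonsplitPlace.isField_localRing_of_nonsplit E v c hcδ hδ w hw).toField
  have hσσ : ∀ x : LocalRing E v, conjLocal E c v (conjLocal E c v x) = x := Liu2021.LemD1OfPlace.conjLocal_conjLocal_apply E v c hcδ hδ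
  obtain ⟨hG₁h, hg₃σ, hG₁d, hg₃0⟩ := blockFrame_gram_hermitian (conjLocal E c v) e H hσσ hH hHd.ne_zero hT
  set x : Matrix (Fin 3) (Fin 3) (LocalRing E v) := H⁻¹ * twistGram (conjLocal E c v) H g.val with hxdef
  have hxγ : Commute x γ.val := commute_inv_mul_twistGram (conjLocal E c v) H hHd (γ := ⟨γ, hγ⟩) (δ := ⟨g * γ * g⁻¹, hg⟩) rfl
  obtain ⟨α, β, t, hxP⟩ := (commute_iff_exists_smul_one_add_smul_of_irreducible hP hA).1 hxγ
  have hPxP : (P⁻¹).val * x * P.val = reindex e e (fromBlocks (α • 1 + β • A) 0 0 !![t]) := by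
    rw [hxP, Matrix.mul_assoc, Matrix.mul_assoc, coe_inv_mul_coe, Matrix.mul_one, ← Matrix.mul_assoc, coe_inv_mul_coe, Matrix.one_mul]
  -- `x⋆ = x` read in the frame
  have hxs : hermStar (conjLocal E c v) H x = x := hermStar_inv_mul_twistGram (conjLocal E c v) H hHd hσσ hH g.val
  rw [hxP, hermStar_conj_blockFrame (conjLocal E c v) e H hT (Ne.isUnit hG₁d) hg₃0] at hxs
  have hxs' := congrArg (fun M => (P⁻¹).val * M * P.val) hxs
  simp only [Matrix.mul_assoc, coe_inv_mul_coe, Matrix.mul_one] at hxs'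
  rw [← Matrix.mul_assoc, ← Matrix.mul_assoc, coe_inv_mul_coe, Matrix.one_mul, Matrix.one_mul, blockFrame_inj] at hxs'
  -- the determinant constraint
  have hdet := det_mul_eq_norm_of_blockFrame (conjLocal E c v) e H hHd hPxP
  have hne : (α • (1 : Matrix (Fin 2) (Fin 2) (LocalRing E v)) + β • A).det * t ≠ 0 := by
    rw [hdet]
    have hgd : g.val.det ≠ 0 := by
      have h := g.isUnit; rw [Matrix.isUnit_iff_isUnit_det] at h; exact h.ne_zero
    exact mul_ne_zero ((map_ne_zero _).2 hgd) hgd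
  exact ⟨α, β, t, hPxP, hxs'.1, hxs'.2, hdet, right_ne_zero_of_mul hne, Ne.isUnit (left_ne_zero_of_mul hne)⟩

/-! ## §3 Two classes: the realised non-norm corner `δ₀`, and every stable conjugate is conjugate to `γ` or to `δ₀` -/

include hcδ hδ in
/-- **THE STABLE CLASS OF A TYPE (2) ELEMENT SPLITS INTO EXACTLY TWO CLASSES** — structure form.  At a non-split finite place `v`, for `H ∈ M₃(E_v)` hermitian with unit
determinant and `γ ∈ U(H)(F_v)` with a block frame `γ P = P [A 0; 0 u]`, `χ_A` IRREDUCIBLE (`T = Z(γ)^{N=1} ≅ T_K × E¹_w`, type (2) of [§3.6]): there is `δ₀ ∈ U(H)(F_v)`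
stably conjugate and NOT conjugate to `γ`, and every `δ′` stably conjugate to `γ` is conjugate to `γ` or to `δ₀` — [Prop. 3.5.2 (c)] «the order of `𝓡(T∕F)` is
`2^{r−1}`», `r = 2`.  (`δ₀` realises the Cartan class `P [Y₀ 0; 0 det Y₀] P⁻¹` with `Y₀` from (N1); the dichotomy is «corner a norm ∕ not», closed by (N2).)
[cite: Rogawski1990, §3.1 p. 19; §3.5 Prop. 3.5.2 (a)(c) p. 29; §3.6 p. 31] [cite: Kottwitz1986, §7] -/
theorem exists_isStablyConj_not_isConj_and_forall (w : PlacesOver E v) (hw : c • w.1 = w.1) (hH : (H.map (conjLocal E c v))ᵀ = H) (hHd : IsUnit H.det)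
    (hγ : γ ∈ unitaryGroup (conjLocal E c v) H) (hP : γ.val * P.val = P.val * reindex e e (fromBlocks A 0 0 !![u])) (hA : Irreducible A.charpoly) :
    ∃ δ₀ : unitaryGroup (conjLocal E c v) H, IsStablyConj (conjLocal E c v) H ⟨γ, hγ⟩ δ₀ ∧ ¬ IsConj (⟨γ, hγ⟩ : unitaryGroup (conjLocal E c v) H) δ₀ ∧
      ∀ δ' : unitaryGroup (conjLocal E c v) H, IsStablyConj (conjLocal E c v) H ⟨γ, hγ⟩ δ' →
        IsConj (⟨γ, hγ⟩ : unitaryGroup (conjLocal E c v) H) δ' ∨ IsConj δ₀ δ' := by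
  letI : Field (LocalRing E v) := (Liu2021.LemD1IndexedNonVacuityNonsplitPlace.isField_localRing_of_nonsplit E v c hcδ hδ w hw).toField
  have hσσ : ∀ x : LocalRing E v, conjLocal E c v (conjLocal E c v x) = x := Liu2021.LemD1OfPlace.conjLocal_conjLocal_apply E v c hcδ hδ
  obtain ⟨d, hd⟩ := exists_delta_mul_self_eq_algebraMap'' E c hcδ hδ
  have hA' : ∀ r : LocalRing E v, A.charpoly.eval r ≠ 0 := eval_charpoly_ne_zero_of_irreducible hA (by simp)
  -- the frame
  obtain ⟨G₁, g₃, hT, hAu, -⟩ := twistGram_blockFrame_eq (conjLocal E c v) e H hσσ hγ hP hA'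
  obtain ⟨hG₁h, hg₃σ, hG₁d, hg₃0⟩ := blockFrame_gram_hermitian (conjLocal E c v) e H hσσ hH hHd.ne_zero hT
  have hG₁u : IsUnit G₁.det := Ne.isUnit hG₁d
  -- (N1): `Y₀ = α₀ + β₀A`, `⋆`-symmetric, `d₀ := det Y₀` a NON-NORM unit
  obtain ⟨α₀, β₀, hY₀s, hY₀u, hY₀n⟩ := exists_hermStar_eq_self_det_not_norm E v c hcδ hδ hd w hw hG₁h hG₁u hAu hA'
  set Y₀ : Matrix (Fin 2) (Fin 2) (LocalRing E v) := α₀ • 1 + β₀ • A with hY₀def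
  set d₀ : LocalRing E v := Y₀.det with hd₀def
  have hd₀σ : (conjLocal E c v) d₀ = d₀ := (det_trace_fixed_of_hermStar_eq_self (conjLocal E c v) G₁ hG₁u hY₀s).1
  have hY₀A : Commute Y₀ A := commute_smul_one_add_smul A α₀ β₀
  -- realise `x₀ = P [Y₀ 0; 0 d₀] P⁻¹`
  set x₀ : Matrix (Fin 3) (Fin 3) (LocalRing E v) := P.val * reindex e e (fromBlocks Y₀ 0 0 !![d₀]) * (P⁻¹).val with hx₀def
  have hx₀γ : Commute x₀ γ.val := commute_conj_blockFrame e hP hY₀A d₀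
  have hx₀s : hermStar (conjLocal E c v) H x₀ = x₀ := by rw [hx₀def, hermStar_conj_blockFrame (conjLocal E c v) e H hT hG₁u hg₃0, hY₀s, hd₀σ]
  have hx₀det : ∃ z : LocalRing E v, IsUnit z ∧ x₀.det = (conjLocal E c v) z * z := ⟨d₀, hY₀u, by rw [hx₀def, det_conj_blockFrame, hd₀σ]⟩
  obtain ⟨g₀, δ₀, hg₀, hst₀, hcl₀⟩ :=
    exists_isStablyConj_inv_mul_twistGram_eq_of_det E v c hcδ hδ w hw hH hHd ⟨γ, hγ⟩ hx₀γ hx₀s hx₀det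
  refine ⟨δ₀, hst₀, ?_, ?_⟩
  · -- `δ₀` is NOT conjugate to `γ`: `T⋆ x₀ T = 1` would make `d₀` a norm
    intro hconj
    rw [isConj_iff_exists_mem, exists_unitary_conj_iff_exists_hermStar_mul_mul_eq_one (conjLocal E c v) H hHd hg₀] at hconj
    obtain ⟨T, hTγ, hT1⟩ := hconj
    have hTc : Commute T.val γ.val := by
      show T.val * γ.val = γ.val * T.val
      rw [← Units.val_mul, hTγ, Units.val_mul]
    obtain ⟨αT, βT, s, hTP⟩ := (commute_iff_exists_smul_one_add_smul_of_irreducible hP hA).1 hTc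
    rw [hcl₀, hTP, hx₀def, hermStar_mul_mul_conj_blockFrame (conjLocal E c v) e hT hG₁u hg₃0] at hT1
    -- compare the corners of `P [..] P⁻¹ = 1 = P [1 0; 0 1] P⁻¹`
    have hT1' := congrArg (fun M => (P⁻¹).val * M * P.val) hT1
    simp only [Matrix.mul_assoc, coe_inv_mul_coe, Matrix.mul_one] at hT1'
    rw [← Matrix.mul_assoc, coe_inv_mul_coe, Matrix.one_mul, ← blockFrame_one e, blockFrame_inj] at hT1'
    apply hY₀n
    have hs0 : s ≠ 0 := by
      intro h0; have h := hT1'.2; rw [h0, mul_zero] at h; exact zero_ne_one h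
    refine ⟨s * d₀, (Ne.isUnit hs0).mul hY₀u, ?_⟩
    rw [map_mul, hd₀σ]
    linear_combination (-d₀) * hT1'.2
  · -- every `δ′` in the stable class: read its Cartan class `P [Y 0; 0 t] P⁻¹`
    intro δ' hst'
    obtain ⟨g, hg'⟩ := isStablyConj_iff.1 hst'
    have hgU : g * γ * g⁻¹ ∈ unitaryGroup (conjLocal E c v) H := by rw [hg']; exact δ'.2
    obtain ⟨α, β, t, hxP, hYs, htσ, hdet, ht0, hYu⟩ := exists_cartan_blockFrame_eq E v c hcδ hδ e w hw hH hHd hγ hP hA hT hgU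
    have hgd : IsUnit g.val.det := by have h := g.isUnit; rwa [Matrix.isUnit_iff_isUnit_det] at h
    have hYA : Commute (α • (1 : Matrix (Fin 2) (Fin 2) (LocalRing E v)) + β • A) A := commute_smul_one_add_smul A α β
    have ePP' : ∀ X : Matrix (Fin 3) (Fin 3) (LocalRing E v), P.val * ((P⁻¹).val * X) = X := fun X => by
      rw [← Matrix.mul_assoc, coe_mul_coe_inv, Matrix.one_mul]
    have hx : H⁻¹ * twistGram (conjLocal E c v) H g.val = P.val * reindex e e (fromBlocks (α • 1 + β • A) 0 0 !![t]) * (P⁻¹).val := by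
      rw [← hxP]; simp only [Matrix.mul_assoc, coe_mul_coe_inv, Matrix.mul_one, ePP']
    -- a frame element `T = P [S 0; 0 s] P⁻¹` as an element of `GL₃` commuting with `γ`
    have hTmk : ∀ (S : Matrix (Fin 2) (Fin 2) (LocalRing E v)) (s : LocalRing E v), Commute S A → IsUnit S.det → s ≠ 0 →
        ∃ T : GL (Fin 3) (LocalRing E v), T.val = P.val * reindex e e (fromBlocks S 0 0 !![s]) * (P⁻¹).val ∧ T * γ = γ * T := by
      intro S s hSA hSu hs
      refine ⟨Matrix.GeneralLinearGroup.mkOfDetNeZero (P.val * reindex e e (fromBlocks S 0 0 !![s]) * (P⁻¹).val)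
        (by rw [det_conj_blockFrame]; exact mul_ne_zero hSu.ne_zero hs), rfl, Units.ext ?_⟩
      exact (commute_conj_blockFrame e hP hSA s).eq
    by_cases htn : ∃ s : LocalRing E v, IsUnit s ∧ t = (conjLocal E c v) s * s
    · -- (i) the corner is a norm ⇒ `δ′ ∼ γ`
      left
      obtain ⟨s, hs, hts⟩ := htn
      obtain ⟨z, hz, hYz⟩ : ∃ z : LocalRing E v, IsUnit z ∧ (α • (1 : Matrix (Fin 2) (Fin 2) (LocalRing E v)) + β • A).det = (conjLocal E c v) z * z :=
        exists_norm_div (conjLocal E c v) hσσ hs hgd hts (by rw [mul_comm]; exact hdet)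
      obtain ⟨α', β', hSu, hYS⟩ := exists_eq_hermStar_mul_self_of_det_norm E v c hcδ hδ hd w hw hG₁h hG₁u hAu hA' hYs ⟨z, hz, hYz⟩
      obtain ⟨T, hTval, hTγ⟩ := hTmk _ s (commute_smul_one_add_smul A α' β') hSu hs.ne_zero
      have h1 : H⁻¹ * twistGram (conjLocal E c v) H g.val =
          hermStar (conjLocal E c v) H T.val * (H⁻¹ * twistGram (conjLocal E c v) H (1 : GL (Fin 3) (LocalRing E v)).val) * T.val := by
        rw [Units.val_one, twistGram_one, Matrix.nonsing_inv_mul H hHd, Matrix.mul_one, hTval,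
          hermStar_mul_conj_blockFrame (conjLocal E c v) e hT hG₁u hg₃0, hx, hYS, hts]
      obtain ⟨uu, huu, huc⟩ := exists_unitary_conj_of_inv_mul_twistGram_eq (conjLocal E c v) H hHd (γ := γ) (δ := γ) (g := 1)
        (by rw [one_mul, inv_one, mul_one]) hg' hTγ h1
      exact ((isConj_iff_exists_mem (conjLocal E c v) δ' ⟨γ, hγ⟩).2 ⟨uu, huu, huc⟩).symm
    · -- (ii) the corner is NOT a norm ⇒ `δ′ ∼ δ₀`
      right
      have htu : IsUnit t := Ne.isUnit ht0
      obtain ⟨s, hs, hts⟩ := exists_norm_mul_of_not_exists_norm E v c hcδ hδ w hw hd₀σ hY₀u htσ htu hY₀n htn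
      -- `Y₀⁻¹ ∈ K[A]`, `⋆`-fixed
      obtain ⟨a₁, b₁, hinvl, hinvr, hinvs⟩ := exists_inv_smul_one_add_smul (conjLocal E c v) hG₁u hY₀u.ne_zero hY₀s
      set Yi : Matrix (Fin 2) (Fin 2) (LocalRing E v) := a₁ • 1 + b₁ • A with hYidef
      set Y : Matrix (Fin 2) (Fin 2) (LocalRing E v) := α • 1 + β • A with hYdef
      -- `W := Y Y₀⁻¹ = α_W + β_W A`, `⋆`-fixed, with NORM determinant
      have hWA : Commute (Y * Yi) A := hYA.mul_left (commute_smul_one_add_smul A a₁ b₁)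
      obtain ⟨αW, βW, hW⟩ := exists_eq_smul_one_add_smul_of_commute hA hWA
      have hcommYYi : Y * Yi = Yi * Y := ((Commute.one_right Yi).smul_right α |>.add_right ((commute_smul_one_add_smul A a₁ b₁).smul_right β)).eq.symm
      have hWs : hermStar (conjLocal E c v) G₁ (αW • (1 : Matrix (Fin 2) (Fin 2) (LocalRing E v)) + βW • A) = αW • 1 + βW • A := by
        rw [← hW, hermStar_mul (conjLocal E c v) G₁ hG₁u, hinvs, hYs, ← hcommYYi]
      have hdi : Yi.det * d₀ = 1 := by
        have h := congrArg Matrix.det hinvl; rwa [Matrix.det_mul, det_one] at h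
      have hWdet : ∃ z : LocalRing E v, IsUnit z ∧ (αW • (1 : Matrix (Fin 2) (Fin 2) (LocalRing E v)) + βW • A).det = (conjLocal E c v) z * z := by
        -- `det Y · d₀ = (conjLocal E c v)(z₁) z₁` (divide `det Y · t` by the norm `(conjLocal E c v)(s) s`), and `det W = det Y · d₀ · (det Y₀⁻¹)²`
        obtain ⟨z₁, hz₁, hz₁eq⟩ := exists_norm_div (conjLocal E c v) hσσ hs hgd (a := (conjLocal E c v) s * s) (b := Y.det * d₀) rfl
          (by rw [← hdet, hts]; ring)
        have hYiσ : (conjLocal E c v) Yi.det = Yi.det := (det_trace_fixed_of_hermStar_eq_self (conjLocal E c v) G₁ hG₁u hinvs).1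
        have hYiu : IsUnit Yi.det := IsUnit.of_mul_eq_one _ hdi
        refine ⟨z₁ * Yi.det, hz₁.mul hYiu, ?_⟩
        rw [← hW, Matrix.det_mul, map_mul, hYiσ]
        calc Y.det * Yi.det = Y.det * Yi.det * (Yi.det * d₀) := by rw [hdi, mul_one]
          _ = Y.det * d₀ * Yi.det * Yi.det := by ring
          _ = (conjLocal E c v) z₁ * z₁ * Yi.det * Yi.det := by rw [hz₁eq]
          _ = (conjLocal E c v) z₁ * Yi.det * (z₁ * Yi.det) := by ring
      obtain ⟨α', β', hSu, hWS⟩ := exists_eq_hermStar_mul_self_of_det_norm E v c hcδ hδ hd w hw hG₁h hG₁u hAu hA' hWs hWdet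
      set S : Matrix (Fin 2) (Fin 2) (LocalRing E v) := α' • 1 + β' • A with hSdef
      obtain ⟨T, hTval, hTγ⟩ := hTmk S s (commute_smul_one_add_smul A α' β') hSu hs.ne_zero
      -- `S⋆ Y₀ S = Y₀ (S⋆ S) = Y₀ W = Y`
      have hAd : A.det ≠ 0 := by
        have h := det_smul_one_add_smul_ne_zero hA' (α := 0) (β := 1) (Or.inr one_ne_zero)
        rwa [zero_smul, zero_add, one_smul] at h
      have hSstar_comm : hermStar (conjLocal E c v) G₁ S * Y₀ = Y₀ * hermStar (conjLocal E c v) G₁ S := by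
        rw [hSdef, hermStar_smul_one_add_smul (conjLocal E c v) G₁ hG₁u hAd hAu]
        exact ((Commute.one_right Y₀).smul_right _ |>.add_right (hY₀A.smul_right _)).eq.symm
      have hblock : hermStar (conjLocal E c v) G₁ S * Y₀ * S = Y := by
        calc hermStar (conjLocal E c v) G₁ S * Y₀ * S = Y₀ * (hermStar (conjLocal E c v) G₁ S * S) := by rw [hSstar_comm, Matrix.mul_assoc]
          _ = Y₀ * (Y * Yi) := by rw [hSdef, ← hWS, ← hW]
          _ = Y := by rw [hcommYYi, ← Matrix.mul_assoc, hinvr, Matrix.one_mul]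
      have h1 : H⁻¹ * twistGram (conjLocal E c v) H g.val = hermStar (conjLocal E c v) H T.val * (H⁻¹ * twistGram (conjLocal E c v) H g₀.val) * T.val := by
        rw [hTval, hcl₀, hx₀def, hermStar_mul_mul_conj_blockFrame (conjLocal E c v) e hT hG₁u hg₃0, hblock, hx, hts, mul_right_comm ((conjLocal E c v) s) d₀ s]
      obtain ⟨uu, huu, huc⟩ := exists_unitary_conj_of_inv_mul_twistGram_eq (conjLocal E c v) H hHd hg₀ hg' hTγ h1
      exact ((isConj_iff_exists_mem (conjLocal E c v) δ' δ₀).2 ⟨uu, huu, huc⟩).symm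

include hcδ hδ in
/-- **THE LOCAL CLASS SET OF A TYPE (2) TORUS HAS TWO ELEMENTS.**  At a finite place `v` of `F` NOT split in `E`, for `H ∈ M₃(E_v)` hermitian with unit determinant and
`γ ∈ U(H)(F_v)` with a block frame `γ P = P [A 0; 0 u]`, `χ_A` irreducible over `E_v` (`T = Z(γ)^{1} ≅ T_K × E¹_w`, type (2) of [§3.6]): the `U(H)(F_v)`-conjugacy
classes inside the stable class of `γ` (★ `conjClassesIn`) are `{[γ], [δ₀]}` with `[γ] ≠ [δ₀]`, hence **`ncard = 2 = 2^{2−1}`** — [Prop. 3.5.2 (c)] «the order of `𝓡(T∕F)`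
is `2^{r−1}`», `r = 2`; the type-(2) twin of ★ `ncard_conjClassesIn_eq_four`.  (The two classes are told apart by the norm test of the `u`-corner of the Cartan class,
i.e. by `κ_H = ±1` of ★ `finKappaAt` read on the `u`-eigenline.) [cite: Rogawski1990, §3.1 p. 19; §3.5 Prop. 3.5.2 (c) p. 29; §3.6 p. 31] [cite: Kottwitz1986, §7] -/
theorem ncard_conjClassesIn_eq_two (w : PlacesOver E v) (hw : c • w.1 = w.1) (hH : (H.map (conjLocal E c v))ᵀ = H) (hHd : IsUnit H.det)
    (hγ : γ ∈ unitaryGroup (conjLocal E c v) H) (hP : γ.val * P.val = P.val * reindex e e (fromBlocks A 0 0 !![u])) (hA : Irreducible A.charpoly) :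
    (conjClassesIn (conjLocal E c v) H ⟨γ, hγ⟩).ncard = 2 := by
  obtain ⟨δ₀, hst₀, hnc, hall⟩ := exists_isStablyConj_not_isConj_and_forall E v c hcδ hδ e w hw hH hHd hγ hP hA
  have hset : conjClassesIn (conjLocal E c v) H ⟨γ, hγ⟩ =
      {ConjClasses.mk (⟨γ, hγ⟩ : unitaryGroup (conjLocal E c v) H), ConjClasses.mk δ₀} := by
    ext cl
    constructor
    · intro hcl
      obtain ⟨δ', rfl⟩ := ConjClasses.exists_rep cl
      rcases hall δ' (mk_mem_conjClassesIn_iff.1 hcl) with h | h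
      · exact Or.inl (ConjClasses.mk_eq_mk_iff_isConj.2 h.symm)
      · exact Or.inr (ConjClasses.mk_eq_mk_iff_isConj.2 h.symm)
    · rintro (h | h)
      · rw [h]; exact mk_mem_conjClassesIn_self _
      · rw [Set.mem_singleton_iff.1 h]; exact mk_mem_conjClassesIn_iff.2 hst₀
  rw [hset, Set.ncard_pair]
  exact fun h => hnc (ConjClasses.mk_eq_mk_iff_isConj.1 h)

include hcδ hδ in
/-- In particular the local class set of a type (2) torus is finite. [cite: Rogawski1990, §3.5 Prop. 3.5.2 (c) p. 29] -/
theorem finite_conjClassesIn_of_blockFrame (w : PlacesOver E v) (hw : c • w.1 = w.1) (hH : (H.map (conjLocal E c v))ᵀ = H) (hHd : IsUnit H.det)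
    (hγ : γ ∈ unitaryGroup (conjLocal E c v) H) (hP : γ.val * P.val = P.val * reindex e e (fromBlocks A 0 0 !![u])) (hA : Irreducible A.charpoly) :
    (conjClassesIn (conjLocal E c v) H ⟨γ, hγ⟩).Finite :=
  Set.finite_of_ncard_ne_zero (by rw [ncard_conjClassesIn_eq_two E v c hcδ hδ e w hw hH hHd hγ hP hA]; norm_num)

end Local

end Literature.NumberTheory.Rogawski1990
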